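import Summits.QuantumFields.YangMills.Theorems.BalabanUVNodesN22KnitRoadRatesSharp
import Summits.QuantumFields.YangMills.Theorems.BalabanUVNodesN22KnitTwoConstants

/-!
# BalabanUVNodes ∕ node N22 = NE9 — ROAD 3 IS RATE-SHARP: a log-chirp tower on the abstract output carriers at which dag-n22-a's
# two-constants road (`…N22KnitTwoConstants`: (P) + oscillation fading at the tower rate `θ` + uniform-margin analyticity with bounds
# growing at any geometric rate ⟹ `NE9 ∧ FadingMemory` at EVERY rate above `θ`) FIRES with a UNIFORM bound, and at which NO moduli
# family with `NE9` fades at the rate `θ` itself; plus the ∃-packaging of both rate certificates on the toy carriers (Track A, DAG node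
# N22 = NE9; cluster K4 «SpineRates»; WIDTH SEAT `pub-ymgap-dag-n22-w1`, harness re-seat g4)

Cell `pub-ymgap`, HUMAN RULING D-0062 (Track A) ∕ D-0149; `--kind proof --supports stmt-QuantumFields-20544 --as helper` (K3⁷
`SpineGivenEndpointR13SepCoPH`), COUNT-NEUTRAL.  THEOREMS ONLY (0 `def`, 0 `sorry`, standard axioms).  Imports this seat's
`…N22KnitRoadRatesSharp` (§1 profile towers with the moduli extraction `pow_mul_abs_deriv_le_moduli_of_ne9`, §2 ROAD 2's certificate) and dag-n22-a's `…N22KnitTwoConstants` (ROAD 3) BY NAME.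

WHY.  ROAD 3 (`N22KnitTwoConstants.ne9_and_fadingMemory_of_osc_analytic_rpow`) concludes node N22's statement shape
`NE9 E (Window γ) κ Λ ∧ FadingMemory C₉ τ_s Λ` at `τ_s = θ^{1−s}μ^{s}` for EVERY `s ∈ ]0,1[` from (P), (O) at the tower rate `θ` and
uniform-margin coordinate-disc analyticity with bounds `M·μ^{age−1}e^{−κd}` — every rate ABOVE `θ`, never `θ` itself (the two-constants
constant `32∕(s²r₁)` blows up as `s ↓ 0`).  THIS FILE certifies that the open condition cannot be closed, even with a UNIFORM analytic
bound (`μ = 1`): at the LOG-CHIRP TOWER `E g U X = e^{−κd(X)}·Σ_{i<k} θ^{k−i}·cos(ν_{k−i} g_i)`, `ν_a = π∕2γ + a·log(θ⁻¹)∕r`, the section in a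
coupling of age `a` extends to an entire function bounded on the strip `|Im z| ≤ r` by `e^{πr∕2γ}θ^{a}e^{a log θ⁻¹} + … = O(1)·e^{−κd}`
UNIFORMLY in the age (the growth of `cosh` across the strip EXACTLY eats the amplitude `θ^{a}`), while its coupling sensitivity at the
interior point `g_i = π∕(2ν_a)` is `θ^{a}ν_a ≥ (log θ⁻¹∕r)·a·θ^{a}` — a factor LINEAR IN THE AGE that no constant `C₉` absorbs at the rate
`θ`, and that every rate `τ > θ` absorbs.  So for K3⁷'s letter block (`Node00/RateRecord11.U3Letters₁₁`: `θ₅`, `C₉`, `ω`) a producer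
feeding `h9` through ROAD 3 books `θ₅ < ω` STRICTLY — the sharp form of the fading-memory letter row on the analytic road; ROAD 2's row is
`θ₅ ≤ ω²` (`…N22KnitRoadRatesSharp`), ROAD 1's is radius growth in the age (`…N22W1FadingMemoryOfCouplingRadii` §3).

WHAT (all [folklore]).
* §3 ROAD 3 at the log-chirp tower: `norm_cos_le_exp_of_abs_im_le` (`‖cos w‖ ≤ e^{r}` on `|Im w| ≤ r`), `pow_mul_exp_mul_log_inv`
  (`θ^{a}e^{a log θ⁻¹} = 1`), ★ `analytic_logChirpTower` (ROAD 3's hypothesis (A)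
  with the UNIFORM disc bound `M = e^{πr∕2γ} + θ∕(1−θ) + 1`, margin `r`, `μ = 1`; the extension is entire, the domain the closed strip
  `|Im z| ≤ r`), ★ `road3_logChirpTower` (ROAD 3 FIRES: for every `s ∈ ]0,1[`, `∃ C₉, NE9 E (Window γ) κ (C₉(θ^{1−s})^{k−i}) ∧
  FadingMemory C₉ θ^{1−s} _`), ★★ `mul_pow_le_moduli_logChirpTower` (EVERY `Λ` with `NE9 E (Window γ) κ Λ` has
  `(log θ⁻¹∕r)(k−i)θ^{k−i} ≤ Λ k i`), ★★ `rate_lt_of_fadingMemory_logChirpTower` (carriers with a domain at every scale: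
  `NE9 … Λ ∧ FadingMemory C₉ τ Λ ∧ 0 ≤ τ ⟹ θ < τ`), `not_fadingMemory_at_towerRate_logChirpTower` (`¬ FadingMemory C₉ θ Λ`, every `C₉`).
* §4 ∃-PACKAGING on dag-n22-a's toy carriers `natCarriers` (domain = scale, `d ≡ 0`), in the style of
  `N22KnitWitness.exists_osc_boundedLipschitz_not_fading`: ★ `exists_road2_rateSharp` ((P) ∧ (O) ∧ (R₂)-uniform ∧ ROAD 2's conclusion at
  `√θ` ∧ the lower bound `(π∕2γ)(√θ)^{k−i} ≤ Λ k i` for every `NE9` family ∧ `√θ ≤ τ` for every fading family) and ★ `exists_road3_rateSharp`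
  ((P) ∧ (O) ∧ (A)-uniform ∧ ROAD 3's conclusion at every `θ^{1−s}` ∧ `(log θ⁻¹∕r)(k−i)θ^{k−i} ≤ Λ k i` ∧ `θ < τ` ∧ `¬ FadingMemory C₉ θ Λ`).
READING.  The three kernel roads to node N22's pair from node N18's rate are now each RATE-CERTIFIED at a model: ROAD 1 needs radii
growing in the age (g2 §3 `letterModuli_le_iff_radii`, g3 `…PhaseTowerSharp`), ROAD 2 gives exactly `√θ`, ROAD 3 exactly «every
`τ > θ`».  None of this says which hypotheses Bałaban's kernels meet — that is the producers' (NODE A ∕ N09 ∕ N10 ∕ N18) business.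

HONEST FRAMING.  MODEL towers on abstract ∕ toy carriers — NOT NODE 00's objects; nothing of Bałaban's construction is asserted or met;
count-neutral A5∕R3-class helper; N22 NOT discharged (typed 28∕28 · discharged 5∕27 UNMOVED — the chair's single count line is the only
count); K3⁷ OPEN, NOT claimed, skeleton v5 untouched; NE5 ∕ NE9 NOT IN PRINT for d = 4; one finite four-torus programme at fixed ε — R4
closes the CONDITIONAL rung `BalabanLadder.UV` only; NOT infinite volume, NOT OS on ℝ⁴, NOT a mass gap, NOT Clay.

References (TYPES only): [Balaban1987RG1] = T. Bałaban, Commun. Math. Phys. **109** (1987) 249–301 — p. 256, Thm 1 p. 259, p. 263 («C^∞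
(or analytic)»), §5 p. 298; the two-constants estimate as typed in `…N22KnitTwoConstants` §§1–2.
-/

noncomputable section

namespace YMDAG.N22.RoadRates

open Set Real Filter Metric
open scoped BigOperators Topology
open Literature.MathematicalPhysics.QuantumFieldTheory.Balaban1983to89
open Literature.MathematicalPhysics.QuantumFieldTheory.Balaban1983to89.T4OutputRate
open Literature.MathematicalPhysics.QuantumFieldTheory.Balaban1983to89.T4CouplingAnalyticityWitness (natCarriers)
open Summit.QuantumFields.YangMills.BalabanUVNodes.N22KnitTwoConstants (ne9_and_fadingMemory_of_osc_analytic_rpow)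

/-! ## §3 ROAD 3 IS RATE-SHARP: the log-chirp tower `φ_a(t) = cos((π∕2γ + a·log(θ⁻¹)∕r)·t)` — uniform-margin analyticity with a
UNIFORM disc bound, ROAD 3 fires at every rate above `θ`, and NO `NE9` moduli family fades at the rate `θ` itself -/

section Road3

variable {C : Carriers} {Bg : Type} {E : Functional C Bg} {θ κ γ r : ℝ}

/-- `‖cos w‖ ≤ e^{r}` on the closed strip `|Im w| ≤ r` (from `2cos w = e^{iw} + e^{−iw}`, `|e^{±iw}| = e^{∓Im w}`). [folklore] -/
theorem norm_cos_le_exp_of_abs_im_le {w : ℂ} {r : ℝ} (hw : |w.im| ≤ r) : ‖Complex.cos w‖ ≤ Real.exp r := by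
  have ha : ‖Complex.exp (w * Complex.I)‖ ≤ Real.exp r := by
    rw [Complex.norm_exp]
    refine Real.exp_monotone ?_
    have : (w * Complex.I).re = -w.im := by simp
    rw [this]; linarith [neg_abs_le (w.im)]
  have hb : ‖Complex.exp (-w * Complex.I)‖ ≤ Real.exp r := by
    rw [Complex.norm_exp]
    refine Real.exp_monotone ?_
    have : (-w * Complex.I).re = w.im := by simp
    rw [this]; linarith [le_abs_self (w.im)]
  have h2 : (2 : ℝ) * ‖Complex.cos w‖ = ‖Complex.exp (w * Complex.I) + Complex.exp (-w * Complex.I)‖ := by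
    rw [← Complex.two_cos, norm_mul, Complex.norm_two]
  linarith [norm_add_le (Complex.exp (w * Complex.I)) (Complex.exp (-w * Complex.I))]

/-- `θ^a · e^{a·log(θ⁻¹)} = 1` (`θ > 0`). [folklore] -/
theorem pow_mul_exp_mul_log_inv {θ : ℝ} (hθ : 0 < θ) (a : ℕ) : θ ^ a * Real.exp (a * Real.log θ⁻¹) = 1 := by
  rw [Real.exp_nat_mul, Real.exp_log (inv_pos.2 hθ), inv_pow, mul_inv_cancel₀ (pow_ne_zero _ hθ.ne')]

/-- **(A) WITH A UNIFORM DISC BOUND** at the log-chirp tower: every young-coupling section `t ↦ E (update g i t) U X` (`a = scale X − i ≥ 1`)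
extends to the ENTIRE function `z ↦ R + e^{−κd}θ^{a}cos(ν_a z)` (`ν_a = π∕2γ + a·log(θ⁻¹)∕r`, `R` the other terms), bounded on the closed
strip `|Im z| ≤ r` — which contains the closed `r`-discs about the window — by `(e^{πr∕2γ} + θ∕(1−θ) + 1)·1^{a−1}·e^{−κd(X)}`: on the strip
`θ^{a}|cos(ν_a z)| ≤ θ^{a}e^{ν_a r} = e^{πr∕2γ}` (`norm_cos_le_exp_of_abs_im_le`, `θ^{a}e^{a log θ⁻¹} = 1`).  This is ROAD 3's hypothesis
(A) of `N22KnitTwoConstants` with UNIFORM `M`, margin `r`, growth `μ = 1`. [folklore] -/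
theorem analytic_logChirpTower
    (hE : ∀ g U X, E g U X = Real.exp (-(κ * C.d X)) *
      ∑ i ∈ Finset.range (C.scale X), θ ^ (C.scale X - i) *
        Real.cos ((π / (2 * γ) + (C.scale X - i : ℕ) * Real.log θ⁻¹ / r) * g i))
    (hγ : 0 < γ) (hθ0 : 0 < θ) (hθ1 : θ < 1) (hr : 0 < r) :
    ∀ g ∈ Window γ, ∀ (U : Bg) (X : C.Dom) (i : ℕ), i < C.scale X → ∃ (F : ℂ → ℂ) (D : Set ℂ),
      DifferentiableOn ℂ F D ∧
      (∀ z ∈ D, ‖F z‖ ≤ (Real.exp (π * r / (2 * γ)) + θ / (1 - θ) + 1) * 1 ^ (C.scale X - 1 - i) * Real.exp (-(κ * C.d X))) ∧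
      (∀ t ∈ Ioc (0 : ℝ) γ, closedBall (t : ℂ) r ⊆ D) ∧
      (∀ t ∈ Ioc (0 : ℝ) γ, F t = (E (Function.update g i t) U X : ℂ)) := by
  intro g hg U X i hi
  set k := C.scale X with hk
  set w := Real.exp (-(κ * C.d X)) with hw
  set a := k - i with ha
  set ν : ℝ := π / (2 * γ) + (a : ℕ) * Real.log θ⁻¹ / r with hν
  have hw0 : 0 < w := Real.exp_pos _
  have hL : 0 < Real.log θ⁻¹ := Real.log_pos ((one_lt_inv₀ hθ0).2 hθ1)
  have hν0 : 0 < ν := by positivity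
  -- the `t`-independent remainder
  set R : ℝ := E (Function.update g i γ) U X - w * θ ^ a * Real.cos (ν * γ) with hR
  have hupd : ∀ t : ℝ, E (Function.update g i t) U X = R + w * θ ^ a * Real.cos (ν * t) := by
    intro t
    have h := profileTower_update_sub_update
      (φ := fun a t => Real.cos ((π / (2 * γ) + (a : ℕ) * Real.log θ⁻¹ / r) * t)) hE g U X hi t γ
    simp only [← hk, ← hw, ← ha, ← hν] at h
    rw [hR]; linarith
  have hRle : |R| ≤ (θ / (1 - θ) + 1) * w := by
    have h1 := abs_profileTower_le (φ := fun a t => Real.cos ((π / (2 * γ) + (a : ℕ) * Real.log θ⁻¹ / r) * t)) hE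
      (fun _ _ => Real.abs_cos_le_one _) hθ0.le hθ1 (Function.update g i γ) U X
    rw [← hw] at h1
    have h2 : |w * θ ^ a * Real.cos (ν * γ)| ≤ w := by
      rw [abs_mul, abs_mul, abs_of_pos hw0, abs_of_nonneg (pow_nonneg hθ0.le _)]
      calc w * θ ^ a * |Real.cos (ν * γ)| ≤ w * 1 * 1 := by
            gcongr
            · exact pow_le_one₀ hθ0.le hθ1.le
            · exact Real.abs_cos_le_one _
        _ = w := by ring
    calc |R| ≤ |E (Function.update g i γ) U X| + |w * θ ^ a * Real.cos (ν * γ)| := abs_sub _ _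
      _ ≤ θ / (1 - θ) * w + w := add_le_add h1 h2
      _ = (θ / (1 - θ) + 1) * w := by ring
  refine ⟨fun z => (R : ℂ) + (w * θ ^ a : ℝ) * Complex.cos (ν * z), {z | |z.im| ≤ r}, ?_, ?_, ?_, ?_⟩
  · -- entire
    refine (Differentiable.differentiableOn ?_)
    exact (differentiable_const _).add ((differentiable_const _).mul
      (Complex.differentiable_cos.comp ((differentiable_const _).mul differentiable_id)))
  · -- the uniform bound on the strip
    intro z hz
    have hz' : |((ν : ℂ) * z).im| ≤ ν * r := by
      have : ((ν : ℂ) * z).im = ν * z.im := by simp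
      rw [this, abs_mul, abs_of_pos hν0]
      exact mul_le_mul_of_nonneg_left hz hν0.le
    have hcos : ‖Complex.cos (ν * z)‖ ≤ Real.exp (ν * r) := norm_cos_le_exp_of_abs_im_le hz'
    have hνr : θ ^ a * Real.exp (ν * r) = Real.exp (π * r / (2 * γ)) := by
      have e : ν * r = π * r / (2 * γ) + a * Real.log θ⁻¹ := by rw [hν]; field_simp
      rw [e, Real.exp_add, mul_comm (Real.exp _), ← mul_assoc, pow_mul_exp_mul_log_inv hθ0, one_mul]
    rw [one_pow, mul_one]
    calc ‖(R : ℂ) + (w * θ ^ a : ℝ) * Complex.cos (ν * z)‖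
        ≤ ‖(R : ℂ)‖ + ‖((w * θ ^ a : ℝ) : ℂ) * Complex.cos (ν * z)‖ := norm_add_le _ _
      _ = |R| + w * θ ^ a * ‖Complex.cos (ν * z)‖ := by
          rw [Complex.norm_real, Real.norm_eq_abs, norm_mul, Complex.norm_real, Real.norm_eq_abs,
            abs_of_nonneg (mul_nonneg hw0.le (pow_nonneg hθ0.le _))]
      _ ≤ (θ / (1 - θ) + 1) * w + w * θ ^ a * Real.exp (ν * r) := by gcongr
      _ = (Real.exp (π * r / (2 * γ)) + θ / (1 - θ) + 1) * w := by rw [mul_assoc, hνr]; ring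
  · -- the closed `r`-discs about the window lie in the strip
    intro t _ z hz
    rw [mem_closedBall, dist_eq_norm] at hz
    show |z.im| ≤ r
    have h := Complex.abs_im_le_norm (z - t)
    simp only [Complex.sub_im, Complex.ofReal_im, sub_zero] at h
    exact h.trans hz
  · -- agreement on the window
    intro t _
    rw [hupd t]
    push_cast
    ring

/-- **ROAD 3 FIRES AT THE LOG-CHIRP TOWER, AT EVERY RATE ABOVE `θ`.**  (P) + (O) (`C₀ = 2θ∕(1−θ)`) + (A) (uniform `M`, `μ = 1`) feed
dag-n22-a's `N22KnitTwoConstants.ne9_and_fadingMemory_of_osc_analytic_rpow` BY NAME: for every `s ∈ ]0, 1[` node N22's statement shape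
holds with the fading rate `θ^{1−s}` — i.e. at EVERY rate in `]θ, 1[`. [folklore] -/
theorem road3_logChirpTower
    (hE : ∀ g U X, E g U X = Real.exp (-(κ * C.d X)) *
      ∑ i ∈ Finset.range (C.scale X), θ ^ (C.scale X - i) *
        Real.cos ((π / (2 * γ) + (C.scale X - i : ℕ) * Real.log θ⁻¹ / r) * g i))
    (hγ : 0 < γ) (hθ0 : 0 < θ) (hθ1 : θ < 1) (hr : 0 < r) {s : ℝ} (hs0 : 0 < s) (hs1 : s < 1) :
    ∃ C₉ : ℝ, NE9 E (Window γ) κ (fun k i => C₉ * (θ ^ (1 - s)) ^ (k - i)) ∧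
      FadingMemory C₉ (θ ^ (1 - s)) (fun k i => C₉ * (θ ^ (1 - s)) ^ (k - i)) := by
  have h1θ : 0 < 1 - θ := by linarith
  have hP := prefixDependenceOn_profileTower (Window γ)
    (φ := fun a t => Real.cos ((π / (2 * γ) + (a : ℕ) * Real.log θ⁻¹ / r) * t)) hE
  have hO := osc_profileTower (γ := γ) (φ := fun a t => Real.cos ((π / (2 * γ) + (a : ℕ) * Real.log θ⁻¹ / r) * t)) hE
    (fun _ _ => Real.abs_cos_le_one _) hθ0.le hθ1
  have hA := analytic_logChirpTower hE hγ hθ0 hθ1 hr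
  have hM : 0 < Real.exp (π * r / (2 * γ)) + θ / (1 - θ) + 1 := by positivity
  have hCM : 2 * θ / (1 - θ) ≤ 2 * (Real.exp (π * r / (2 * γ)) + θ / (1 - θ) + 1) := by
    have : 0 ≤ θ / (1 - θ) := by positivity
    have h2 : 2 * θ / (1 - θ) = 2 * (θ / (1 - θ)) := by ring
    rw [h2]
    nlinarith [Real.exp_pos (π * r / (2 * γ))]
  have h := ne9_and_fadingMemory_of_osc_analytic_rpow (μ := 1) hP hO hA (by positivity) hθ0 hM hθ1.le hCM hr hγ hs0 hs1
  rw [Real.one_rpow, mul_one] at h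
  exact ⟨_, h.1, h.2⟩

/-- **NO MODULI FAMILY FADES AT THE RATE `θ` AT THE LOG-CHIRP TOWER.**  For EVERY `Λ` with `NE9 E (Window γ) κ Λ`:
`(log(θ⁻¹)∕r)·(k − i)·θ^{k−i} ≤ Λ k i` (`i < k = scale X`) — the section in the coupling `i` is `θ^{a}cos(ν_a t)`, whose derivative at
the interior point `t = π∕(2ν_a) < γ` has size `θ^{a}ν_a ≥ θ^{a}·a·log(θ⁻¹)∕r`: a factor LINEAR IN THE AGE on top of `θ^{age}`. [folklore] -/
theorem mul_pow_le_moduli_logChirpTower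
    (hE : ∀ g U X, E g U X = Real.exp (-(κ * C.d X)) *
      ∑ i ∈ Finset.range (C.scale X), θ ^ (C.scale X - i) *
        Real.cos ((π / (2 * γ) + (C.scale X - i : ℕ) * Real.log θ⁻¹ / r) * g i))
    (hγ : 0 < γ) (hθ0 : 0 < θ) (hθ1 : θ < 1) (hr : 0 < r) {Λ : ℕ → ℕ → ℝ} (hN : NE9 E (Window γ) κ Λ)
    (U : Bg) (X : C.Dom) {i : ℕ} (hi : i < C.scale X) :
    Real.log θ⁻¹ / r * (C.scale X - i : ℕ) * θ ^ (C.scale X - i) ≤ Λ (C.scale X) i := by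
  have hL : 0 < Real.log θ⁻¹ := Real.log_pos ((one_lt_inv₀ hθ0).2 hθ1)
  have ha1 : 1 ≤ C.scale X - i := by omega
  set ν : ℝ := π / (2 * γ) + (C.scale X - i : ℕ) * Real.log θ⁻¹ / r with hν
  have hπγ : 0 < π / (2 * γ) := by positivity
  have hνgt : π / (2 * γ) < ν := by
    rw [hν]
    have : 0 < (C.scale X - i : ℕ) * Real.log θ⁻¹ / r := by
      have : (1 : ℝ) ≤ (C.scale X - i : ℕ) := by exact_mod_cast ha1
      positivity
    linarith
  have hν0 : 0 < ν := hπγ.trans hνgt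
  -- the interior point where the phase is `π/2`
  set s : ℝ := π / 2 / ν with hs
  have hs0 : 0 < s := by positivity
  have hsγ : s < γ := by
    rw [hs, div_lt_iff₀ hν0]
    have : π / 2 = π / (2 * γ) * γ := by field_simp
    rw [this, mul_comm γ ν]
    exact mul_lt_mul_of_pos_right hνgt hγ
  have hνs : ν * s = π / 2 := by rw [hs]; field_simp
  have hD : HasDerivAt (fun t : ℝ => Real.cos (ν * t)) (-Real.sin (ν * s) * (ν * 1)) s :=
    ((hasDerivAt_id' s).const_mul ν).cos
  have h := pow_mul_abs_deriv_le_moduli_of_ne9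
    (φ := fun a t => Real.cos ((π / (2 * γ) + (a : ℕ) * Real.log θ⁻¹ / r) * t)) hE hγ hθ0.le hN U X hi ⟨hs0, hsγ⟩ hD
  rw [hνs, Real.sin_pi_div_two, mul_one, neg_one_mul, abs_neg, abs_of_pos hν0] at h
  have hθa : 0 < θ ^ (C.scale X - i) := pow_pos hθ0 _
  calc Real.log θ⁻¹ / r * (C.scale X - i : ℕ) * θ ^ (C.scale X - i)
      ≤ ν * θ ^ (C.scale X - i) := by
        refine mul_le_mul_of_nonneg_right ?_ hθa.le
        rw [hν]
        have : Real.log θ⁻¹ / r * (C.scale X - i : ℕ) = (C.scale X - i : ℕ) * Real.log θ⁻¹ / r := by ring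
        rw [this]; linarith
    _ = θ ^ (C.scale X - i) * ν := mul_comm _ _
    _ ≤ Λ (C.scale X) i := h

/-- **COROLLARY — `θ < τ` STRICTLY FOR EVERY FADING FAMILY AT THE LOG-CHIRP TOWER; IN PARTICULAR `¬ FadingMemory C₉ θ Λ`.**  If the
carriers have a domain at every scale, any `Λ` with `NE9 E (Window γ) κ Λ ∧ FadingMemory C₉ τ Λ` (`τ ≥ 0`) has `θ < τ`: otherwise
`(log θ⁻¹∕r)·k·θ^{k} ≤ C₉θ^{k}` at every scale `k`, absurd.  So on ROAD 3's hypotheses ((P) + (O) at rate `θ` + uniform-margin analyticity,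
even with a UNIFORM bound) the open condition «every rate ABOVE `θ`» of `N22KnitTwoConstants` CANNOT be closed to «at `θ`»: a K3⁷ letter
block fed by this road carries `θ₅ < ω`, never `θ₅ = ω`. [folklore] -/
theorem rate_lt_of_fadingMemory_logChirpTower
    (hE : ∀ g U X, E g U X = Real.exp (-(κ * C.d X)) *
      ∑ i ∈ Finset.range (C.scale X), θ ^ (C.scale X - i) *
        Real.cos ((π / (2 * γ) + (C.scale X - i : ℕ) * Real.log θ⁻¹ / r) * g i))
    (hγ : 0 < γ) (hθ0 : 0 < θ) (hθ1 : θ < 1) (hr : 0 < r) (hsurj : ∀ k : ℕ, ∃ X : C.Dom, C.scale X = k) (U : Bg)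
    {Λ : ℕ → ℕ → ℝ} (hN : NE9 E (Window γ) κ Λ) {C₉ τ : ℝ} (hF : FadingMemory C₉ τ Λ) (hτ : 0 ≤ τ) :
    θ < τ := by
  have hL : 0 < Real.log θ⁻¹ / r := div_pos (Real.log_pos ((one_lt_inv₀ hθ0).2 hθ1)) hr
  by_contra hle
  rw [not_lt] at hle
  have hC9 : 0 ≤ C₉ := by have h := hF 0 0 le_rfl; simpa using h.1.trans h.2
  -- at every scale `k`, in the coupling `0`: `(L/r)·k·θ^k ≤ C₉ τ^k ≤ C₉ θ^k`, hence `(L/r)·k ≤ C₉`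
  have key : ∀ k : ℕ, 1 ≤ k → Real.log θ⁻¹ / r * k ≤ C₉ := by
    intro k hk
    obtain ⟨X, hX⟩ := hsurj k
    have h1 := mul_pow_le_moduli_logChirpTower hE hγ hθ0 hθ1 hr hN U X (i := 0) (by omega)
    have h2 := (hF (C.scale X) 0 (Nat.zero_le _)).2
    rw [hX, Nat.sub_zero] at h1 h2
    have h3 : C₉ * τ ^ k ≤ C₉ * θ ^ k := mul_le_mul_of_nonneg_left (pow_le_pow_left₀ hτ hle k) hC9
    exact le_of_mul_le_mul_right ((h1.trans h2).trans h3) (pow_pos hθ0 k)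
  obtain ⟨n, hn⟩ := exists_nat_gt (C₉ / (Real.log θ⁻¹ / r))
  have h := key (n + 1) (by omega)
  rw [div_lt_iff₀ hL] at hn
  have : (n : ℝ) ≤ (n + 1 : ℕ) := by push_cast; linarith
  nlinarith

/-- At the log-chirp tower NO `NE9` moduli family has `FadingMemory C₉ θ Λ` — the tower rate `θ` itself is NOT a fading rate, for any
constant `C₉`. [folklore] -/
theorem not_fadingMemory_at_towerRate_logChirpTower
    (hE : ∀ g U X, E g U X = Real.exp (-(κ * C.d X)) *
      ∑ i ∈ Finset.range (C.scale X), θ ^ (C.scale X - i) *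
        Real.cos ((π / (2 * γ) + (C.scale X - i : ℕ) * Real.log θ⁻¹ / r) * g i))
    (hγ : 0 < γ) (hθ0 : 0 < θ) (hθ1 : θ < 1) (hr : 0 < r) (hsurj : ∀ k : ℕ, ∃ X : C.Dom, C.scale X = k) (U : Bg)
    {Λ : ℕ → ℕ → ℝ} (hN : NE9 E (Window γ) κ Λ) (C₉ : ℝ) : ¬ FadingMemory C₉ θ Λ :=
  fun hF => lt_irrefl θ (rate_lt_of_fadingMemory_logChirpTower hE hγ hθ0 hθ1 hr hsurj U hN hF hθ0.le)

end Road3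


/-! ## §4 ∃-PACKAGING ON THE TOY CARRIERS `natCarriers` (domain = scale, `d ≡ 0`): in the style of `N22KnitWitness.exists_osc_boundedLipschitz_not_fading`; the hypotheses of both rate certificates are jointly inhabited -/

section Exists

/-- **ROAD 2 IS RATE-SHARP (∃-form).**  For `0 < θ < 1`, `γ > 0` there is a one-step output functional on the toy carriers with (P), (O) at
the tower rate `θ` (`C₀ = 2θ∕(1−θ)`) and (R₂) with the UNIFORM constant `(π∕2γ)²` (`μ = 1`) — so `N22KnitDiscrete.ne9_and_fadingMemory_of_osc_secondDiff`
applies and DOES give `NE9 ∧ FadingMemory` at the rate `√θ` — at which EVERY `NE9` moduli family has `(π∕2γ)(√θ)^{k−i} ≤ Λ k i`, hence every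
fading family has rate `τ ≥ √θ`. [folklore] -/
theorem exists_road2_rateSharp {γ κ θ : ℝ} (hγ : 0 < γ) (hθ0 : 0 < θ) (hθ1 : θ < 1) :
    ∃ E : Functional natCarriers Unit,
      PrefixDependenceOn E (Window γ) ∧
      (∀ g ∈ Window γ, ∀ g' ∈ Window γ, ∀ (U : Unit) (X : ℕ) (a : ℕ), a ≤ natCarriers.scale X →
        (∀ n, a ≤ n → g n = g' n) →
        |E g U X - E g' U X| ≤ 2 * θ / (1 - θ) * θ ^ (natCarriers.scale X - a) * Real.exp (-(κ * natCarriers.d X))) ∧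
      (∀ g ∈ Window γ, ∀ (U : Unit) (X : ℕ) (i : ℕ), i < natCarriers.scale X → ∀ t d : ℝ, 0 < d →
        t - d ∈ Ioc (0 : ℝ) γ → t + d ∈ Ioc (0 : ℝ) γ →
          |E (Function.update g i (t + d)) U X - 2 * E (Function.update g i t) U X + E (Function.update g i (t - d)) U X| ≤
            (π / (2 * γ)) ^ 2 * 1 ^ (natCarriers.scale X - 1 - i) * Real.exp (-(κ * natCarriers.d X)) * d ^ 2) ∧
      (∃ C₉ : ℝ, NE9 E (Window γ) κ (fun k i => C₉ * Real.sqrt θ ^ (k - i)) ∧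
        FadingMemory C₉ (Real.sqrt θ) (fun k i => C₉ * Real.sqrt θ ^ (k - i))) ∧
      (∀ Λ : ℕ → ℕ → ℝ, NE9 E (Window γ) κ Λ → ∀ k i : ℕ, i < k → π / (2 * γ) * Real.sqrt θ ^ (k - i) ≤ Λ k i) ∧
      (∀ (Λ : ℕ → ℕ → ℝ) (C₉ τ : ℝ), NE9 E (Window γ) κ Λ → FadingMemory C₉ τ Λ → 0 ≤ τ → Real.sqrt θ ≤ τ) := by
  set E : Functional natCarriers Unit := fun g _ X => Real.exp (-(κ * natCarriers.d X)) *
    ∑ i ∈ Finset.range (natCarriers.scale X), θ ^ (natCarriers.scale X - i) *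
      Real.cos (π / (2 * γ) * (Real.sqrt θ ^ (natCarriers.scale X - i))⁻¹ * g i) with hEdef
  have hE : ∀ g U X, E g U X = Real.exp (-(κ * natCarriers.d X)) *
      ∑ i ∈ Finset.range (natCarriers.scale X), θ ^ (natCarriers.scale X - i) *
        Real.cos (π / (2 * γ) * (Real.sqrt θ ^ (natCarriers.scale X - i))⁻¹ * g i) := fun _ _ _ => rfl
  have hsurj : ∀ k : ℕ, ∃ X : natCarriers.Dom, natCarriers.scale X = k := fun k => ⟨k, rfl⟩
  refine ⟨E, prefixDependenceOn_profileTower (Window γ)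
      (φ := fun a t => Real.cos (π / (2 * γ) * (Real.sqrt θ ^ a)⁻¹ * t)) hE,
    osc_profileTower (γ := γ) (φ := fun a t => Real.cos (π / (2 * γ) * (Real.sqrt θ ^ a)⁻¹ * t)) hE
      (fun _ _ => Real.abs_cos_le_one _) hθ0.le hθ1,
    secondDiff_chirpTower hE hθ0, road2_chirpTower hE hγ hθ0 hθ1, fun Λ hN k i hi => ?_,
    fun Λ C₉ τ hN hF hτ => sqrt_le_rate_of_fadingMemory_chirpTower hE hγ hθ0 hθ1 hsurj () hN hF hτ⟩
  exact sqrt_pow_le_moduli_chirpTower hE hγ hθ0 hθ1 hN () k hi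

/-- **ROAD 3 IS RATE-SHARP (∃-form).**  For `0 < θ < 1`, `γ > 0`, `r > 0` there is a one-step output functional on the toy carriers with (P),
(O) at the tower rate `θ` (`C₀ = 2θ∕(1−θ)`) and uniform-margin analyticity (A) with a UNIFORM bound (margin `r`, `μ = 1`) — so
`N22KnitTwoConstants.ne9_and_fadingMemory_of_osc_analytic_rpow` applies and DOES give `NE9 ∧ FadingMemory` at every rate `θ^{1−s}`,
`s ∈ ]0,1[` — at which EVERY `NE9` moduli family has `(log θ⁻¹∕r)(k−i)θ^{k−i} ≤ Λ k i`, hence every fading family has rate `τ > θ`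
STRICTLY and none fades at the rate `θ`. [folklore] -/
theorem exists_road3_rateSharp {γ κ θ r : ℝ} (hγ : 0 < γ) (hθ0 : 0 < θ) (hθ1 : θ < 1) (hr : 0 < r) :
    ∃ E : Functional natCarriers Unit,
      PrefixDependenceOn E (Window γ) ∧
      (∀ g ∈ Window γ, ∀ g' ∈ Window γ, ∀ (U : Unit) (X : ℕ) (a : ℕ), a ≤ natCarriers.scale X →
        (∀ n, a ≤ n → g n = g' n) →
        |E g U X - E g' U X| ≤ 2 * θ / (1 - θ) * θ ^ (natCarriers.scale X - a) * Real.exp (-(κ * natCarriers.d X))) ∧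
      (∀ g ∈ Window γ, ∀ (U : Unit) (X : ℕ) (i : ℕ), i < natCarriers.scale X → ∃ (F : ℂ → ℂ) (D : Set ℂ),
        DifferentiableOn ℂ F D ∧
        (∀ z ∈ D, ‖F z‖ ≤ (Real.exp (π * r / (2 * γ)) + θ / (1 - θ) + 1) * 1 ^ (natCarriers.scale X - 1 - i) *
          Real.exp (-(κ * natCarriers.d X))) ∧
        (∀ t ∈ Ioc (0 : ℝ) γ, closedBall (t : ℂ) r ⊆ D) ∧
        (∀ t ∈ Ioc (0 : ℝ) γ, F t = (E (Function.update g i t) U X : ℂ))) ∧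
      (∀ s : ℝ, 0 < s → s < 1 → ∃ C₉ : ℝ, NE9 E (Window γ) κ (fun k i => C₉ * (θ ^ (1 - s)) ^ (k - i)) ∧
        FadingMemory C₉ (θ ^ (1 - s)) (fun k i => C₉ * (θ ^ (1 - s)) ^ (k - i))) ∧
      (∀ Λ : ℕ → ℕ → ℝ, NE9 E (Window γ) κ Λ → ∀ k i : ℕ, i < k →
        Real.log θ⁻¹ / r * (k - i : ℕ) * θ ^ (k - i) ≤ Λ k i) ∧
      (∀ (Λ : ℕ → ℕ → ℝ) (C₉ τ : ℝ), NE9 E (Window γ) κ Λ → FadingMemory C₉ τ Λ → 0 ≤ τ → θ < τ) ∧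
      (∀ (Λ : ℕ → ℕ → ℝ) (C₉ : ℝ), NE9 E (Window γ) κ Λ → ¬ FadingMemory C₉ θ Λ) := by
  set E : Functional natCarriers Unit := fun g _ X => Real.exp (-(κ * natCarriers.d X)) *
    ∑ i ∈ Finset.range (natCarriers.scale X), θ ^ (natCarriers.scale X - i) *
      Real.cos ((π / (2 * γ) + (natCarriers.scale X - i : ℕ) * Real.log θ⁻¹ / r) * g i) with hEdef
  have hE : ∀ g U X, E g U X = Real.exp (-(κ * natCarriers.d X)) *
      ∑ i ∈ Finset.range (natCarriers.scale X), θ ^ (natCarriers.scale X - i) *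
        Real.cos ((π / (2 * γ) + (natCarriers.scale X - i : ℕ) * Real.log θ⁻¹ / r) * g i) := fun _ _ _ => rfl
  have hsurj : ∀ k : ℕ, ∃ X : natCarriers.Dom, natCarriers.scale X = k := fun k => ⟨k, rfl⟩
  refine ⟨E, prefixDependenceOn_profileTower (Window γ)
      (φ := fun a t => Real.cos ((π / (2 * γ) + (a : ℕ) * Real.log θ⁻¹ / r) * t)) hE,
    osc_profileTower (γ := γ) (φ := fun a t => Real.cos ((π / (2 * γ) + (a : ℕ) * Real.log θ⁻¹ / r) * t)) hE
      (fun _ _ => Real.abs_cos_le_one _) hθ0.le hθ1,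
    analytic_logChirpTower hE hγ hθ0 hθ1 hr, fun s hs0 hs1 => road3_logChirpTower hE hγ hθ0 hθ1 hr hs0 hs1,
    fun Λ hN k i hi => ?_,
    fun Λ C₉ τ hN hF hτ => rate_lt_of_fadingMemory_logChirpTower hE hγ hθ0 hθ1 hr hsurj () hN hF hτ,
    fun Λ C₉ hN => not_fadingMemory_at_towerRate_logChirpTower hE hγ hθ0 hθ1 hr hsurj () hN C₉⟩
  exact mul_pow_le_moduli_logChirpTower hE hγ hθ0 hθ1 hr hN () k hi

end Exists


end YMDAG.N22.RoadRates

end
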